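import Summits.KontsevichZagierPeriods.KontsevichZagierPeriods.Theorems.SoloInformedSegPolar
import Summits.KontsevichZagierPeriods.KontsevichZagierPeriods.Theorems.SoloInformedPresRatOne
import Literature.NumberTheory.Transcendental.KZDilationRationalNormalForm
import Literature.NumberTheory.Transcendental.KZHomotopyMoves
import Literature.NumberTheory.Transcendental.SemialgebraicDerivativeProofs
import HarnessLib
import HarnessLib.Audit

/-!
# SoloInformed — every rational piece over an interval lies in the span of points and segments

Solo programme `solo-KontsevichZagierPeriods-informed`, session s112 (kernel project
«`SoloInformedKZPUpTo 1` unconditionally from the tree's kernel Baker theorem»), file 9.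

**Piece lemma** (`soloInformed_restrict_interval_mem_segSpan`).  Let `r` be a one-dimensional
representation with integrand `P/Q` (`P, Q ∈ ℚ[X]`, `Q ≠ 0` on the domain) and let `(u, v)` be an
interval with algebraic end points inside the domain.  Then the class of the restricted piece
`[(u, v), P/Q]` lies in `soloInformedSegSpan`.  Proof: close the interval (null edges), pass to
lowest terms `P₁/Q₁` (`Q₁ ≠ 0` on `[u, v]` by integrability), translate by a rational `m ∈ (u, v)`
(rule 2) so that `0` lies inside, take the tree's Baker normal form
`P₂/Q₂ = ρ' + Σ_k (polar terms)` on a rational interval `(a, b) ⊇ [u − m, v − m]` free of zeros of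
`Q₂` (`KZ.BakerSectorComplex.exists_bakerNormalForm`), split the integrand (rule 1); the exact
part is `[pt, ρ(v') − ρ(u')]` by the Newton–Leibniz move (`KZ.exists_band_newtonLeibniz`; the
value is algebraic since `ρ` is semialgebraic), and each polar part is a segment (file 8).

References: M. Kontsevich, D. Zagier, *Periods* (2001), §1.2; A. Baker (1975), Ch. 2; this work.
-/

noncomputable section

open scoped BigOperators ComplexConjugate Polynomial
open MeasureTheory Set Filter
open Literature.ModelTheory.ExponentialFields
open Literature.NumberTheory.Transcendental Literature.NumberTheory.Transcendental.KZ

namespace Summit.KontsevichZagierPeriods.KontsevichZagierPeriods.Theorems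

/-! ### Helpers -/

/-- Rational room around `[u, v]` free of zeros of `Q`. -/
theorem soloInformed_exists_rat_room {Q : ℚ[X]} (hQ0 : Q ≠ 0) {u v : ℝ}
    (hne : ∀ t ∈ Icc u v, (Polynomial.aeval t Q : ℝ) ≠ 0) :
    ∃ a₀ b₀ : ℚ, (a₀ : ℝ) < u ∧ v < (b₀ : ℝ) ∧
      ∀ t ∈ Ioo (a₀ : ℝ) b₀, (Polynomial.aeval t Q : ℝ) ≠ 0 := by
  classical
  set Z : Finset ℝ := (Q.aroots ℝ).toFinset with hZ
  have hmemZ : ∀ t : ℝ, (Polynomial.aeval t Q : ℝ) = 0 → t ∈ Z := fun t ht => by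
    rw [hZ, Multiset.mem_toFinset, Polynomial.mem_aroots]
    exact ⟨hQ0, ht⟩
  set Zl := Z.filter (· < u) with hZl
  set a₁ : ℝ := if h : Zl.Nonempty then Zl.max' h else u - 1 with ha₁
  have ha₁u : a₁ < u := by
    rw [ha₁]
    split_ifs with h
    · exact (Finset.mem_filter.1 (Zl.max'_mem h)).2
    · linarith
  have hZl_le : ∀ t ∈ Z, t < u → t ≤ a₁ := fun t ht htu => by
    have hmem : t ∈ Zl := Finset.mem_filter.2 ⟨ht, htu⟩
    rw [ha₁, dif_pos ⟨t, hmem⟩]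
    exact Zl.le_max' t hmem
  set Zr := Z.filter (v < ·) with hZr
  set b₁ : ℝ := if h : Zr.Nonempty then Zr.min' h else v + 1 with hb₁
  have hvb₁ : v < b₁ := by
    rw [hb₁]
    split_ifs with h
    · exact (Finset.mem_filter.1 (Zr.min'_mem h)).2
    · linarith
  have hZr_le : ∀ t ∈ Z, v < t → b₁ ≤ t := fun t ht hvt => by
    have hmem : t ∈ Zr := Finset.mem_filter.2 ⟨ht, hvt⟩
    rw [hb₁, dif_pos ⟨t, hmem⟩]
    exact Zr.min'_le t hmem
  obtain ⟨a₀, ha₁₀, ha₀u⟩ := exists_rat_btwn ha₁u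
  obtain ⟨b₀, hvb₀, hb₀₁⟩ := exists_rat_btwn hvb₁
  refine ⟨a₀, b₀, ha₀u, hvb₀, fun t ht h0 => ?_⟩
  have htZ := hmemZ t h0
  by_cases htu : t < u
  · have := hZl_le t htZ htu
    linarith [ht.1]
  by_cases hvt : v < t
  · have := hZr_le t htZ hvt
    linarith [ht.2]
  exact hne t ⟨not_lt.1 htu, not_lt.1 hvt⟩ h0

/-- Rational integrands are semialgebraic and continuous on bands `[u, v]` missing the poles
(the one-variable polynomials are read in the coordinate of `ℝ¹`). -/
theorem soloInformed_ratFun_bandUV {u v : ℝ} (hu : IsAlgebraic ℚ u) (hv : IsAlgebraic ℚ v)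
    (P Q : ℚ[X]) (hQ : ∀ y ∈ soloInformedBandUV u v, (Polynomial.aeval (y 0) Q : ℝ) ≠ 0) :
    IsSemialgebraicFunOn ℚ (soloInformedBandUV u v)
        (fun y => (Polynomial.aeval (y 0) P : ℝ) / Polynomial.aeval (y 0) Q) ∧
      ContinuousOn
        (fun y : Fin 1 → ℝ => (Polynomial.aeval (y 0) P : ℝ) / Polynomial.aeval (y 0) Q)
        (soloInformedBandUV u v) := by
  have hmv : ∀ (F : ℚ[X]) (z : Fin 1 → ℝ),
      MvPolynomial.aeval z (Polynomial.aeval (MvPolynomial.X 0 : MvPolynomial (Fin 1) ℚ) F) =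
        (Polynomial.aeval (z 0) F : ℝ) := fun F z => by
    rw [← Polynomial.aeval_algHom_apply, MvPolynomial.aeval_X]
  refine ⟨(isSemialgebraicFunOn_aeval_div_aeval (soloInformed_isSemialgebraic_bandUV hu hv)
    (Polynomial.aeval (MvPolynomial.X 0 : MvPolynomial (Fin 1) ℚ) P)
    (Polynomial.aeval (MvPolynomial.X 0 : MvPolynomial (Fin 1) ℚ) Q)
    (fun y hy => by rw [hmv]; exact hQ y hy)).congr fun y _ => by simp only [hmv], ?_⟩
  exact ((Polynomial.continuous_aeval P).comp (continuous_apply 0)).continuousOn.div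
    ((Polynomial.continuous_aeval Q).comp (continuous_apply 0)).continuousOn hQ

/-- The closed-band representation `[[u, v], P/Q]`. -/
def soloInformedRatRep {u v : ℝ} (hu : IsAlgebraic ℚ u) (hv : IsAlgebraic ℚ v) (P Q : ℚ[X])
    (hQ : ∀ y ∈ soloInformedBandUV u v, (Polynomial.aeval (y 0) Q : ℝ) ≠ 0) : IntegralRep 1 :=
  ⟨soloInformedBandUV u v, fun y => (Polynomial.aeval (y 0) P : ℝ) / Polynomial.aeval (y 0) Q,
    soloInformed_isSemialgebraic_bandUV hu hv, (soloInformed_ratFun_bandUV hu hv P Q hQ).1,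
    (soloInformed_ratFun_bandUV hu hv P Q hQ).2.integrableOn_compact
      (soloInformed_isCompact_bandUV u v)⟩

/-- The polar representation `[[u, v], Re(G(−ν)/(1 − νx))]`. -/
def soloInformedPolRep {G ν : ℂ} (hG : IsAlgebraic ℚ G) (hν : IsAlgebraic ℚ ν) {u v : ℝ}
    (hu : IsAlgebraic ℚ u) (hv : IsAlgebraic ℚ v)
    (hne : ∀ y ∈ soloInformedBandUV u v, 1 - ν * ((y 0 : ℝ) : ℂ) ≠ 0) : IntegralRep 1 :=
  ⟨soloInformedBandUV u v, soloInformedPolFun G ν, soloInformed_isSemialgebraic_bandUV hu hv,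
    soloInformed_isSemialgebraicFunOn_polFun hG hν hu hv hne,
    (soloInformed_continuousOn_polFun G hne).integrableOn_compact
      (soloInformed_isCompact_bandUV u v)⟩

/-- Off the pole: `0 < 1 − p x ∨ q x ≠ 0` (the normal form's side condition) gives
`1 − (p + iq)x ≠ 0` on the whole band `[u, v] ⊆ (a, b)`. -/
theorem soloInformed_one_sub_mul_ne_zero_of_band {p q a b u v : ℝ}
    (h : ∀ x ∈ Ioo a b, 0 < 1 - p * x ∨ q * x ≠ 0) (hIcc : Icc u v ⊆ Ioo a b) :
    ∀ t ∈ Icc u v, (1 : ℂ) - ((p : ℂ) + (q : ℂ) * Complex.I) * (t : ℂ) ≠ 0 := by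
  intro t ht h0
  have hre := congrArg Complex.re h0
  have him := congrArg Complex.im h0
  simp only [Complex.sub_re, Complex.one_re, Complex.mul_re, Complex.add_re, Complex.ofReal_re,
    Complex.mul_im, Complex.ofReal_im, Complex.I_re, Complex.I_im, Complex.add_im,
    Complex.zero_re, Complex.sub_im, Complex.one_im, Complex.zero_im] at hre him
  rcases h t (hIcc ht) with h | h
  · linarith
  · exact h (by linarith)

/-- Algebraicity kit for the piece lemma: rationals are algebraic reals, `i` is algebraic, and
`γ + iδ` is algebraic for algebraic reals `γ, δ`. -/
theorem soloInformed_isAlgebraic_kit :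
    (∀ m : ℚ, IsAlgebraic ℚ (m : ℝ)) ∧ IsAlgebraic ℚ Complex.I ∧
      ∀ γ δ : ℝ, IsAlgebraic ℚ γ → IsAlgebraic ℚ δ →
        IsAlgebraic ℚ ((γ : ℂ) + (δ : ℂ) * Complex.I) := by
  have hI : IsAlgebraic ℚ Complex.I :=
    IsAlgebraic.of_pow (n := 2) two_pos (by rw [Complex.I_sq]; exact isAlgebraic_one.neg)
  refine ⟨fun m => by simpa using isAlgebraic_algebraMap (R := ℚ) (A := ℝ) m, hI,
    fun γ δ hγ hδ => ?_⟩
  have h := soloInformed_isAlgebraic_ofReal_pair hγ hδ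
  exact h.1.add (h.2.mul hI)

/-! ### The piece lemma -/

/-- **Piece lemma.** A rational one-dimensional piece over an interval with algebraic end points
lies in the span of points and segments. [Kontsevich–Zagier 2001, §1.2; Baker 1975, Ch. 2;
this work] -/
theorem soloInformed_restrict_interval_mem_segSpan (r : IntegralRep 1) {P Q : ℚ[X]}
    (hq : ∀ x ∈ r.domain, (Polynomial.aeval (x 0) Q : ℝ) ≠ 0)
    (hpq : EqOn r.integrand
      (fun x => (Polynomial.aeval (x 0) P : ℝ) / Polynomial.aeval (x 0) Q) r.domain)
    {u v : ℝ} (huv : u < v) (hu : IsAlgebraic ℚ u) (hv : IsAlgebraic ℚ v)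
    (hI : IsSemialgebraic ℚ {w : Fin 1 → ℝ | ∀ i, u < w i ∧ w i < v})
    (hsub : {w : Fin 1 → ℝ | ∀ i, u < w i ∧ w i < v} ⊆ r.domain) :
    of (r.restrict _ hI hsub) ∈ soloInformedSegSpan := by
  classical
  have hs0 : ∀ (x : Fin 0 → ℝ) (t : ℝ), (Fin.snoc x t : Fin 1 → ℝ) 0 = t := fun _ _ => rfl
  have hl0 : ∀ z : Fin 1 → ℝ, z (Fin.last 0) = z 0 := fun _ => rfl
  /- Step 0: lowest terms, `Q₁ ≠ 0` on `[u, v]` (as in the rational normal form of s109). -/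
  obtain ⟨x₀, hx₀⟩ : ∃ x₀ : Fin 1 → ℝ, x₀ ∈ {w : Fin 1 → ℝ | ∀ i, u < w i ∧ w i < v} :=
    ⟨fun _ => (u + v) / 2, fun i => ⟨by linarith, by linarith⟩⟩
  have hQ0 : Q ≠ 0 := by
    intro h
    apply hq x₀ (hsub hx₀)
    rw [h, map_zero]
  obtain ⟨hcop, hQ₁0, hred⟩ := soloInformed_lowestTerms P Q hQ0
  set P₁ := P / GCDMonoid.gcd P Q with hP₁
  set Q₁ := Q / GCDMonoid.gcd P Q with hQ₁
  have hQt : ∀ t ∈ Ioo u v, (Polynomial.aeval t Q : ℝ) ≠ 0 := fun t ht =>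
    hq (fun _ => t) (hsub fun i => ht)
  have hint : IntegrableOn (fun t : ℝ => (Polynomial.aeval t P₁ : ℝ) / Polynomial.aeval t Q₁)
      (Ioo u v) := by
    set e : ℝ → (Fin 1 → ℝ) := fun t _ => t with he
    set Φ₁ := MeasurableEquiv.funUnique (Fin 1) ℝ with hΦ₁
    have hΦe : ⇑Φ₁.symm = e := by
      funext t i
      rw [hΦ₁, MeasurableEquiv.funUnique_symm_apply]
      exact uniqueElim_const t i
    have h := ((volume_preserving_funUnique (Fin 1) ℝ).symm Φ₁).integrableOn_comp_preimage
      Φ₁.symm.measurableEmbedding (f := r.integrand) (s := r.domain)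
    rw [hΦe] at h
    have hA : IntegrableOn (r.integrand ∘ e) (e ⁻¹' r.domain) := h.mpr r.integrableOn
    have hsubA : Ioo u v ⊆ e ⁻¹' r.domain := fun t ht => hsub fun i => ht
    refine (hA.mono_set hsubA).congr_fun (fun t ht => ?_) measurableSet_Ioo
    have hmem : e t ∈ r.domain := hsubA ht
    show r.integrand (e t) = _
    rw [hpq hmem]
    show (Polynomial.aeval t P : ℝ) / Polynomial.aeval t Q = _
    exact (hred t (hQt t ht)).2
  have hQ₁ne : ∀ a ∈ Icc u v, (Polynomial.aeval a Q₁ : ℝ) ≠ 0 := fun a ha =>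
    soloInformed_aeval_ne_zero_of_isCoprime hcop hQ₁0 huv ha hint
  /- Step 1: rational room and a rational centre. -/
  obtain ⟨a₀, b₀, ha₀u, hvb₀, hQab⟩ := soloInformed_exists_rat_room hQ₁0 hQ₁ne
  obtain ⟨m, hum, hmv⟩ := exists_rat_btwn huv
  have hmalg : IsAlgebraic ℚ (m : ℝ) := soloInformed_isAlgebraic_kit.1 m
  set u' : ℝ := u - m with hu'def
  set v' : ℝ := v - m with hv'def
  have hu'v' : u' < v' := by rw [hu'def, hv'def]; linarith
  have hu'alg : IsAlgebraic ℚ u' := hu.sub hmalg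
  have hv'alg : IsAlgebraic ℚ v' := hv.sub hmalg
  set a : ℝ := (a₀ : ℝ) - m with hadef
  set b : ℝ := (b₀ : ℝ) - m with hbdef
  have hau' : a < u' := by rw [hadef, hu'def]; linarith
  have hv'b : v' < b := by rw [hbdef, hv'def]; linarith
  have ha : a < 0 := by rw [hadef]; linarith
  have hb : 0 < b := by rw [hbdef]; linarith
  have hab : a < b := ha.trans hb
  have hIcc : Icc u' v' ⊆ Ioo a b := fun t ht => ⟨hau'.trans_le ht.1, ht.2.trans_lt hv'b⟩
  have hIab : IsSemialgebraic ℚ {t : Fin 1 → ℝ | t 0 ∈ Ioo a b} := by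
    have h := KZ.BallPeeling.isSemialgebraic_Ioo₁ (a₀ - m) (b₀ - m)
    convert h using 3
    push_cast
    rw [hadef, hbdef]
  /- Step 2: the translated fraction and its Baker normal form. -/
  set P₂ : ℚ[X] := P₁.comp (Polynomial.X + Polynomial.C m) with hP₂def
  set Q₂ : ℚ[X] := Q₁.comp (Polynomial.X + Polynomial.C m) with hQ₂def
  have hcomp : ∀ (F : ℚ[X]) (t : ℝ),
      (Polynomial.aeval t (F.comp (Polynomial.X + Polynomial.C m)) : ℝ) =
        Polynomial.aeval (t + m) F := fun F t => by
    rw [Polynomial.aeval_comp, map_add, Polynomial.aeval_X, Polynomial.aeval_C, eq_ratCast]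
  have hQ₂ : ∀ x ∈ Ioo a b, (Polynomial.aeval x Q₂ : ℝ) ≠ 0 := fun x hx => by
    rw [hQ₂def, hcomp]
    refine hQab _ ⟨?_, ?_⟩
    · have := hx.1; rw [hadef] at this; linarith
    · have := hx.2; rw [hbdef] at this; linarith
  obtain ⟨ρ, A, p, q, γ, δ, hρsa, hρan, hp, hq', hγ, hδ, hpos, hnf⟩ :=
    BakerSectorComplex.exists_bakerNormalForm P₂ Q₂ ha hb hIab hQ₂
  have hderρ : ∀ x ∈ Ioo a b, HasDerivAt ρ (deriv ρ x) x := fun x hx =>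
    (hρan x hx).differentiableAt.hasDerivAt
  have hρ'sa : IsSemialgebraicFunOn ℚ {t : Fin 1 → ℝ | t 0 ∈ Ioo a b} (fun t => deriv ρ (t 0)) :=
    IsSemialgebraicFunOn.hasDerivAt_isSemialgebraic_holds a b ρ (deriv ρ) hab hρsa hderρ
  /- Step 3: the closed band `[[u, v], P₁/Q₁]` and the piece. -/
  have hQ₁band : ∀ y ∈ soloInformedBandUV u v, (Polynomial.aeval (y 0) Q₁ : ℝ) ≠ 0 :=
    fun y hy => hQ₁ne _ (soloInformed_mem_bandUV.1 hy)
  set Rc := soloInformedRatRep hu hv P₁ Q₁ hQ₁band with hRc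
  obtain ⟨r', hr'd, hr'i, hrel'⟩ := of_sub_of_restrict_openBand_mem_relations (N := 0)
    (soloInformed_isSemialgebraicFunOn_const_base hu) (soloInformed_isSemialgebraicFunOn_const_base hv)
    Rc rfl
  have hpiece : of (r.restrict _ hI hsub) - of r' ∈ relations := by
    refine of_sub_of_mem_relations_of_eqOn ?_ fun z hz => ?_
    · rw [hr'd, IntegralRep.domain_restrict]
      ext z
      simp only [mem_setOf_eq, mem_univ, true_and, Fin.forall_fin_one]
      rfl
    · rw [IntegralRep.domain_restrict] at hz
      have hz' : z 0 ∈ Ioo u v := hz 0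
      rw [IntegralRep.integrand_restrict, hpq (hsub hz), hr'i, hRc]
      show (Polynomial.aeval (z 0) P : ℝ) / Polynomial.aeval (z 0) Q =
        Polynomial.aeval (z 0) P₁ / Polynomial.aeval (z 0) Q₁
      exact (hred _ (hQt _ hz')).2
  /- Step 4: translation to `[[u', v'], P₂/Q₂]`. -/
  have hQ₂band : ∀ y ∈ soloInformedBandUV u' v', (Polynomial.aeval (y 0) Q₂ : ℝ) ≠ 0 :=
    fun y hy => hQ₂ _ (hIcc (soloInformed_mem_bandUV.1 hy))
  set Rt := soloInformedRatRep hu'alg hv'alg P₂ Q₂ hQ₂band with hRt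
  have htrans : of Rt - of Rc ∈ relations := by
    refine of_sub_of_mem_relations_of_affine (m := 0) (G := (univ : Set (Fin 0 → ℝ))) isOpen_univ
      (α := fun _ => (m : ℝ)) (β := fun _ => (1 : ℝ)) (a := fun _ => u') (b := fun _ => v')
      (a' := fun _ => u) (b' := fun _ => v)
      (soloInformed_isSemialgebraicFunOn_const_base hmalg)
      (soloInformed_isSemialgebraicFunOn_const_base isAlgebraic_one)
      (differentiableOn_const _) (differentiableOn_const _) (fun _ _ => one_pos)
      Rt Rc rfl rfl (fun _ _ => by rw [hu'def]; ring) (fun _ _ => by rw [hv'def]; ring)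
      fun z _ => ?_
    rw [hRt, hRc]
    show (Polynomial.aeval (z 0) P₂ : ℝ) / Polynomial.aeval (z 0) Q₂ =
      Polynomial.aeval ((Fin.snoc (Fin.init z) ((m : ℝ) + 1 * z (Fin.last 0)) : Fin 1 → ℝ) 0) P₁ /
        Polynomial.aeval ((Fin.snoc (Fin.init z) ((m : ℝ) + 1 * z (Fin.last 0)) : Fin 1 → ℝ) 0) Q₁
          * 1
    rw [hs0, hl0 z, hP₂def, hQ₂def, hcomp, hcomp, mul_one,
      show z 0 + (m : ℝ) = m + 1 * z 0 by ring]
  /- Step 5: the exact part by Newton–Leibniz. -/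
  have hbandsub : soloInformedBandUV u' v' ⊆ {t : Fin 1 → ℝ | t 0 ∈ Ioo a b} := fun z hz =>
    hIcc (soloInformed_mem_bandUV.1 hz)
  have hbandsa := soloInformed_isSemialgebraic_bandUV hu'alg hv'alg
  have hρcont : ContinuousOn ρ (Icc u' v') := fun t ht =>
    (hρan t (hIcc ht)).continuousAt.continuousWithinAt
  have hρ'cont : ContinuousOn (deriv ρ) (Icc u' v') := fun t ht =>
    (hρan t (hIcc ht)).deriv.continuousAt.continuousWithinAt
  have hcontf : ContinuousOn (fun z : Fin 1 → ℝ => deriv ρ (z 0)) (soloInformedBandUV u' v') :=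
    hρ'cont.comp (continuous_apply 0).continuousOn fun z hz => soloInformed_mem_bandUV.1 hz
  have halgρ : IsAlgebraic ℚ (ρ v' - ρ u') :=
    (hρsa.isAlgebraic_apply_one (hIcc ⟨hu'v'.le, le_rfl⟩) hv'alg).sub
      (hρsa.isAlgebraic_apply_one (hIcc ⟨le_rfl, hu'v'.le⟩) hu'alg)
  obtain ⟨rb, rd, hrbd, hrbi, hrdd, hrdi, hNL⟩ := exists_band_newtonLeibniz (N := 0)
    isSemialgebraic_univ (fun _ => u') (fun _ => v')
    (soloInformed_isSemialgebraicFunOn_const_base hu'alg)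
    (soloInformed_isSemialgebraicFunOn_const_base hv'alg) (fun _ _ => hu'v'.le)
    (fun z => ρ (z 0)) (fun z => deriv ρ (z 0)) (hρsa.mono hbandsub hbandsa)
    (hρ'sa.mono hbandsub hbandsa)
    (fun x _ => by
      show ContinuousOn (fun t : ℝ => ρ t) (Icc u' v')
      exact hρcont)
    (fun x _ t ht => by
      show HasDerivAt (fun t : ℝ => ρ t) (deriv ρ t) t
      exact hderρ t (hIcc (Ioo_subset_Icc_self ht)))
    (hcontf.integrableOn_compact (soloInformed_isCompact_bandUV u' v'))
    (by
      show IsSemialgebraicFunOn ℚ (univ : Set (Fin 0 → ℝ)) (fun _ => ρ v' - ρ u')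
      exact soloInformed_isSemialgebraicFunOn_const_base halgρ)
    (by
      show IntegrableOn (fun _ : Fin 0 → ℝ => ρ v' - ρ u') univ
      exact integrableOn_const (hs := by rw [volume_pi, Measure.pi_univ]; simp))
  have hpt : of rd - of (soloInformedPtRep (ρ v' - ρ u') halgρ) ∈ relations := by
    refine of_sub_of_mem_relations_of_eqOn (by rw [soloInformed_ptRep_domain, hrdd]) fun x _ => ?_
    rw [hrdi, soloInformed_ptRep_integrand]
    show ρ _ - ρ _ = ρ v' - ρ u'
    rw [hs0, hs0]
  /- Step 6: the polar parts are segments. -/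
  set Gc : Fin A → ℂ := fun k => (γ k : ℂ) + (δ k : ℂ) * Complex.I with hGc
  set νc : Fin A → ℂ := fun k => (p k : ℂ) + (q k : ℂ) * Complex.I with hνc
  have hGalg : ∀ k, IsAlgebraic ℚ (Gc k) := fun k =>
    soloInformed_isAlgebraic_kit.2.2 _ _ (hγ k) (hδ k)
  have hνalg : ∀ k, IsAlgebraic ℚ (νc k) := fun k =>
    soloInformed_isAlgebraic_kit.2.2 _ _ (hp k) (hq' k)
  have hνne : ∀ k, ∀ t ∈ Icc u' v', 1 - νc k * (t : ℂ) ≠ 0 := fun k =>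
    soloInformed_one_sub_mul_ne_zero_of_band (hpos k) hIcc
  have hνne' : ∀ k, ∀ y ∈ soloInformedBandUV u' v', 1 - νc k * ((y 0 : ℝ) : ℂ) ≠ 0 :=
    fun k y hy => hνne k _ (soloInformed_mem_bandUV.1 hy)
  set Rk : Fin A → IntegralRep 1 := fun k =>
    soloInformedPolRep (hGalg k) (hνalg k) hu'alg hv'alg (hνne' k) with hRk
  have hseg : ∀ k, SoloInformedSegAdm (Gc k) ((1 - νc k * (v' : ℂ)) / (1 - νc k * (u' : ℂ))) ∧
      of (soloInformedSegRep (Gc k) ((1 - νc k * (v' : ℂ)) / (1 - νc k * (u' : ℂ)))) - of (Rk k) ∈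
        relations := fun k =>
    soloInformed_segRep_sub_polRep_mem_relations (hGalg k) (hνalg k) hu'alg hv'alg hu'v' (hνne k)
      (Rk k) rfl fun _ _ => rfl
  /- Step 7: splitting the integrand of `[[u', v'], P₂/Q₂]`. -/
  have hsplit : of Rt - of rb - ∑ k, of (Rk k) ∈ relations := by
    refine of_sub_of_sub_sum_mem_relations A Rt rb Rk hrbd (fun k => rfl) fun z hz => ?_
    have hz' : z 0 ∈ Ioo a b := hbandsub hz
    rw [hrbi, hRt]
    show (Polynomial.aeval (z 0) P₂ : ℝ) / Polynomial.aeval (z 0) Q₂ =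
      deriv ρ (z 0) + ∑ k, soloInformedPolFun (Gc k) (νc k) z
    rw [hnf _ hz']
    congr 1
    exact Finset.sum_congr rfl fun k _ => (soloInformed_polFun_apply_eq (γ k) (δ k) (p k) (q k) z).symm
  /- Step 8: assembling the membership. -/
  have hRk_mem : ∀ k, of (Rk k) ∈ soloInformedSegSpan := fun k =>
    soloInformed_mem_segSpan_of_sub_mem (by simpa using relations.neg_mem (hseg k).2)
      (soloInformed_segRep_mem_segSpan (hseg k).1)
  have hrd_mem : of rd ∈ soloInformedSegSpan :=
    soloInformed_mem_segSpan_of_sub_mem hpt (soloInformed_ptRep_mem_segSpan _ halgρ)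
  have hrb_mem : of rb ∈ soloInformedSegSpan := soloInformed_mem_segSpan_of_sub_mem hNL hrd_mem
  have hRt_mem : of Rt ∈ soloInformedSegSpan := by
    refine soloInformed_mem_segSpan_of_sub_mem (y := of rb + ∑ k, of (Rk k)) ?_
      (soloInformedSegSpan.add_mem hrb_mem (soloInformed_sum_mem_segSpan _ fun k _ => hRk_mem k))
    simpa [sub_sub] using hsplit
  have hRc_mem : of Rc ∈ soloInformedSegSpan :=
    soloInformed_mem_segSpan_of_sub_mem (by simpa using relations.neg_mem htrans) hRt_mem
  have hr'_mem : of r' ∈ soloInformedSegSpan :=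
    soloInformed_mem_segSpan_of_sub_mem (by simpa using relations.neg_mem hrel') hRc_mem
  exact soloInformed_mem_segSpan_of_sub_mem hpiece hr'_mem

end Summit.KontsevichZagierPeriods.KontsevichZagierPeriods.Theorems
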